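import Mathlib
import Summits.ResolutionOfSingularities.ResolutionOfSingularities.Theorems.WeightedInvariantLocalWeightedDropWildMonicSCleanDefs
import Summits.ResolutionOfSingularities.ResolutionOfSingularities.Theorems.WeightedInvariantLocalWeightedDropWildMonicShiftOrderCases
import Literature.AlgebraicGeometry.Resolution.WeightedShear

/-!
# `WeightedInvariant.LocalWeightedDrop`, line `hasse-ridge-face-selection`, S3ρ sub-stub S3ρD `stub_wildMonicSurfaceDescent`:
# the second coefficient-ideal order `s` under RE-CENTRING — Perlega Lemma 5.2.2 IS Lemma 5.1.1 for the `s`-LINE WEIGHT `(δ!, s)`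

Crux item stmt-ResolutionOfSingularities-8899 `LocalWeightedDrop` (route `ResolutionOfSingularities/WeightedInvariant`), engine of
the door `HypersurfaceCentreConstruction` stmt-ResolutionOfSingularities-19897.  [OURS · L1 W4.3, chain w43, res-L1-w43-stub-7 (second
seat on S3ρ under res-type-083); item (C4) of `L/res-L1-w43-stub-7/S3RHOD-ROADMAP.md`, part B (spec `…/S3RHOD-SPEC-C4.md`).  MODEL:
S. Perlega, thesis Wien 2017 / arXiv:2011.14443, Ch. 5 §2 Lemma 5.2.2 («(1) if `ord g_j ≥ Δ − j·s/d!` for all `j` then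
`ord J̃_{-2} ≥ ord J_{-2}`; (3) if some `ord g_j < Δ − j·s/d!` then `ord J̃_{-2} < ord J_{-2}`»), for re-centrings that PRESERVE THE SETTING
(same exceptional exponents `r`, same `d = ord I_{-1}`).  Nothing here is a statement of H. Hironaka's manuscript
[claim: Hironaka2017, status: under-review]; OUR objects.]

THE OBSERVATION (ours; it makes §5.2 a corollary of §5.1 at the level of orders).  With `δ = dRes`, `r = excExp` and the reduced scaled
point `Q = N_i·e − r` of a monomial `e` of slot `i`, Perlega's standing inequality «`ord f_{i,j} ≥ (c−i)Δ − j·s/d!`» reads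
`δ!·Q₀ ≥ s·(δ − Q₁)`, i.e. `δ!·Q₀ + s·Q₁ ≥ s·δ`: ALL REDUCED POINTS LIE ON OR ABOVE THE `s`-LINE through `(0, δ)`; and for ANY weight `w`,
`N_i·w(e) = w(Q) + w(r)` (`slotWeight_mul_weight`).  Hence for every natural `s`:
  `s ≤ sFlag E N  ⟺  s·δ + w_s(r) ≤ m_{w_s}(A)`,  `w_s = (δ!, s)`  (`natCast_le_sFlag_iff_le_wMin`)
— the second coefficient-ideal order is read off the minimal scaled weighted slot orders `m_w` of `…WildMonicWClean` for the LINE WEIGHTS.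
Consequences for a re-centring `shift d A g` that preserves `(δ, r)`:
* `natCast_le_sFlag_shift` — PERLEGA LEMMA 5.2.2 (1): `s ≤ sFlag(A)` and `s·δ + w_s(r) ≤ d!·ord_{w_s}(g)` give `s ≤ sFlag(shift d A g)`
  (by `min (m, d!·ord g) ≤` every re-centred slot order, `min_le_slotWOrd_shift` p504433);
* `sFlag_shift_lt` — PERLEGA LEMMA 5.2.2 (3): `s ≤ sFlag(A)` and `d!·ord_{w_s}(g) < s·δ + w_s(r)` give `sFlag(shift d A g) < s`
  (by Lemma 5.1.1 (3) `wMin_shift_eq_of_gt`);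
* `exists_onSLine_of_sFlag_eq` — a finite `s = sFlag` is attained: some monomial's reduced point lies ON the `s`-line;
* `onSLine_natCast_iff`, `aboveSLine_natCast_iff` — the `ℕ`-forms `δ!·Q₀ + s·Q₁ = s·δ` / `> s·δ` used by the maximality file.
-/

set_option linter.dupNamespace false -- mandated namespace of this single-conjunct summit

noncomputable section

namespace Summit.ResolutionOfSingularities.ResolutionOfSingularities.Theorems

namespace WildMonic

open MvPowerSeries MonicDescent

variable {k : Type} [Field k] {d : ℕ}

/-! ## `coeffOrd` against natural numbers; attainment -/

section PointSet

variable {S : Set (Fin 2 →₀ ℕ)} {δ : ℕ}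

/-- `s ≤ coeffOrd δ S` iff `s·(δ − P₁) ≤ δ!·P₀` at every point below the row `δ`. -/
theorem natCast_le_coeffOrd_iff {s : ℕ} :
    (s : ℕ∞) ≤ coeffOrd δ S ↔ ∀ P ∈ S, P 1 < δ → s * (δ - P 1) ≤ δ.factorial * P 0 := by
  rw [le_coeffOrd_iff]
  refine forall₂_congr fun P _ => forall_congr' fun h1 => ?_
  have hdvd : (δ - P 1) ∣ δ.factorial := Nat.dvd_factorial (by omega) (by omega)
  rw [Nat.cast_le, Nat.div_mul_right_comm hdvd, Nat.le_div_iff_mul_le (by omega)]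

/-- Equivalently, EVERY point lies on or above the `s`-line `δ!·P₀ + s·P₁ = s·δ` (rows at height `≥ δ` automatically). -/
theorem natCast_le_coeffOrd_iff' {s : ℕ} :
    (s : ℕ∞) ≤ coeffOrd δ S ↔ ∀ P ∈ S, s * δ ≤ δ.factorial * P 0 + s * P 1 := by
  rw [natCast_le_coeffOrd_iff]
  refine forall₂_congr fun P _ => ⟨fun h => ?_, fun h h1 => ?_⟩
  · by_cases h1 : P 1 < δ
    · have h2 := h h1
      have h3 : s * P 1 ≤ s * δ := Nat.mul_le_mul_left s h1.le
      rw [Nat.mul_sub] at h2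
      omega
    · have h3 : s * δ ≤ s * P 1 := Nat.mul_le_mul_left s (not_lt.1 h1)
      omega
  · have h3 : s * P 1 ≤ s * δ := Nat.mul_le_mul_left s h1.le
    rw [Nat.mul_sub]
    omega

/-- A finite `coeffOrd` is ATTAINED at a point below the row `δ`. -/
theorem exists_coeffOrd_eq (hne : ∃ P ∈ S, P 1 < δ) :
    ∃ P ∈ S, P 1 < δ ∧ coeffOrd δ S = ((δ.factorial / (δ - P 1) * P 0 : ℕ) : ℕ∞) := by
  classical
  obtain ⟨P, hP, h1⟩ := hne
  have hV : Set.Nonempty {n : ℕ | ∃ P ∈ S, P 1 < δ ∧ δ.factorial / (δ - P 1) * P 0 = n} := ⟨_, P, hP, h1, rfl⟩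
  obtain ⟨P₀, hP₀, h1₀, hn⟩ := Nat.sInf_mem hV
  refine ⟨P₀, hP₀, h1₀, le_antisymm (coeffOrd_le hP₀ h1₀) ?_⟩
  rw [le_coeffOrd_iff]
  intro Q hQ hQ1
  rw [hn]
  have hQV : δ.factorial / (δ - Q 1) * Q 0 ∈ {n : ℕ | ∃ P ∈ S, P 1 < δ ∧ δ.factorial / (δ - P 1) * P 0 = n} := ⟨Q, hQ, hQ1, rfl⟩
  exact_mod_cast Nat.sInf_le hQV

/-- `ℕ`-form of «on the `s`-line»: `P₁ < δ` and `δ!·P₀ + s·P₁ = s·δ`. -/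
theorem onSLine_natCast_iff {s : ℕ} {P : Fin 2 →₀ ℕ} :
    OnSLine δ (s : ℕ∞) P ↔ P 1 < δ ∧ δ.factorial * P 0 + s * P 1 = s * δ := by
  unfold OnSLine
  refine and_congr_right fun h1 => ?_
  have h3 : s * P 1 ≤ s * δ := Nat.mul_le_mul_left s h1.le
  rw [← Nat.cast_mul, Nat.cast_inj, Nat.mul_sub]
  omega

/-- `ℕ`-form of «strictly above the `s`-line»: `P₁ < δ → s·δ < δ!·P₀ + s·P₁`. -/
theorem aboveSLine_natCast_iff {s : ℕ} {P : Fin 2 →₀ ℕ} :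
    AboveSLine δ (s : ℕ∞) P ↔ (P 1 < δ → s * δ < δ.factorial * P 0 + s * P 1) := by
  unfold AboveSLine
  refine forall_congr' fun h1 => ?_
  have h3 : s * P 1 ≤ s * δ := Nat.mul_le_mul_left s h1.le
  rw [← Nat.cast_mul, Nat.cast_lt, Nat.mul_sub]
  omega

end PointSet

/-! ## Slot orders through reduced points -/

section Slots

variable (E : Finset (Fin 2)) (A : Fin d → MvPowerSeries (Fin 2) k)

/-- `N_i·e = Q + r` for the reduced scaled point `Q` of a monomial `e` of slot `i`. -/
theorem slotWeight_smul_eq_redPt_add (i : Fin d) {e : Fin 2 →₀ ℕ} (he : coeff e (A i) ≠ 0) :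
    slotWeight d i • e = redPt A E i e + excExp E (newtonSet A) := by
  ext l
  have h := excExp_le (E := E) (smul_mem_newtonSet A i he) l
  simp only [Finsupp.smul_apply, smul_eq_mul] at h
  simp only [Finsupp.smul_apply, smul_eq_mul, Finsupp.add_apply, redPt_apply]
  omega

/-- Hence `N_i·w(e) = w(Q) + w(r)` for every weight `w`. -/
theorem slotWeight_mul_weight (w : Fin 2 → ℕ) (i : Fin d) {e : Fin 2 →₀ ℕ} (he : coeff e (A i) ≠ 0) :
    slotWeight d i * Finsupp.weight w e = Finsupp.weight w (redPt A E i e) + Finsupp.weight w (excExp E (newtonSet A)) := by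
  have h := congrArg (Finsupp.weight w) (slotWeight_smul_eq_redPt_add E A i he)
  rwa [map_nsmul, map_add, smul_eq_mul] at h

/-- A bound below all scaled support weights of a slot bounds its scaled weighted order, and conversely. -/
theorem le_slotWOrd_iff (w : Fin 2 → ℕ) (j : Fin d) {x : ℕ∞} :
    x ≤ slotWOrd w A j ↔ ∀ e, coeff e (A j) ≠ 0 → x ≤ ((slotWeight d j * Finsupp.weight w e : ℕ) : ℕ∞) := by
  unfold slotWOrd
  constructor
  · intro h e he
    refine le_trans h ?_
    push_cast
    gcongr
    exact weightedOrder_le w he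
  · intro h
    by_cases hF : A j = 0
    · rw [hF, weightedOrder_zero, ENat.mul_top (by exact_mod_cast (slotWeight_pos j).ne')]; exact le_top
    · obtain ⟨e, he, hwe⟩ := exists_coeff_ne_zero_and_weightedOrder w (f := A j)
        (ENat.coe_toNat (by rwa [Ne, weightedOrder_eq_top_iff]))
      rw [← hwe]; exact_mod_cast h e he

/-- `x ≤ m_w(A)` iff `x ≤ w(Q) + w(r)` for the reduced scaled point `Q` of every monomial. -/
theorem le_wMin_iff_redPt (w : Fin 2 → ℕ) {x : ℕ∞} :
    x ≤ wMin w A ↔ ∀ (i : Fin d) (e : Fin 2 →₀ ℕ), coeff e (A i) ≠ 0 →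
      x ≤ ((Finsupp.weight w (redPt A E i e) + Finsupp.weight w (excExp E (newtonSet A)) : ℕ) : ℕ∞) := by
  unfold wMin
  rw [le_iInf_iff]
  refine forall_congr' fun i => ?_
  rw [le_slotWOrd_iff]
  refine forall₂_congr fun e he => ?_
  rw [slotWeight_mul_weight E A w i he]

/-- Quantifying over the reduced set is quantifying over monomials. -/
theorem forall_mem_reduce_newtonSet_iff {P : (Fin 2 →₀ ℕ) → Prop} :
    (∀ Q ∈ reduce (excExp E (newtonSet A)) (newtonSet A), P Q) ↔
      ∀ (i : Fin d) (e : Fin 2 →₀ ℕ), coeff e (A i) ≠ 0 → P (redPt A E i e) := by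
  constructor
  · exact fun h i e he => h _ (redPt_mem_reduce A E i he)
  · rintro h Q ⟨P', ⟨i, e, he, rfl⟩, rfl⟩
    exact h i e he

/-- `s ≤ sFlag` iff every monomial's reduced scaled point lies on or above the `s`-line. -/
theorem natCast_le_sFlag_iff (s : ℕ) : (s : ℕ∞) ≤ sFlag E (newtonSet A) ↔
    ∀ (i : Fin d) (e : Fin 2 →₀ ℕ), coeff e (A i) ≠ 0 →
      s * dRes E (newtonSet A) ≤ (dRes E (newtonSet A)).factorial * redPt A E i e 0 + s * redPt A E i e 1 := by
  unfold sFlag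
  rw [natCast_le_coeffOrd_iff', forall_mem_reduce_newtonSet_iff]

/-- THE DICTIONARY `§5.2 = §5.1 for line weights`: `s ≤ sFlag E N ⟺ s·δ + w_s(r) ≤ m_{w_s}(A)` for the `s`-LINE WEIGHT `w_s = (δ!, s)`. -/
theorem natCast_le_sFlag_iff_le_wMin (s : ℕ) : (s : ℕ∞) ≤ sFlag E (newtonSet A) ↔
    ((s * dRes E (newtonSet A) + Finsupp.weight ![(dRes E (newtonSet A)).factorial, s] (excExp E (newtonSet A)) : ℕ) : ℕ∞) ≤
      wMin ![(dRes E (newtonSet A)).factorial, s] A := by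
  rw [natCast_le_sFlag_iff, le_wMin_iff_redPt E A]
  refine forall₃_congr fun i e _ => ?_
  rw [Nat.cast_le, Literature.AlgebraicGeometry.Resolution.WeightedShear.weight_fin_two,
    Literature.AlgebraicGeometry.Resolution.WeightedShear.weight_fin_two, add_le_add_iff_right]

/-- A FINITE `s = sFlag` IS ATTAINED: some monomial's reduced scaled point lies ON the `s`-line. -/
theorem exists_onSLine_of_sFlag_eq {s : ℕ} (hs : sFlag E (newtonSet A) = s) :
    ∃ (i : Fin d) (e : Fin 2 →₀ ℕ), coeff e (A i) ≠ 0 ∧ OnSLine (dRes E (newtonSet A)) (s : ℕ∞) (redPt A E i e) := by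
  have hne : ∃ P ∈ reduce (excExp E (newtonSet A)) (newtonSet A), P 1 < dRes E (newtonSet A) := by
    by_contra h
    have htop : sFlag E (newtonSet A) = ⊤ := coeffOrd_eq_top_iff.2 fun P hP => not_lt.1 fun hlt => h ⟨P, hP, hlt⟩
    rw [hs] at htop
    exact ENat.coe_ne_top s htop
  obtain ⟨P, hP, h1, heq⟩ := exists_coeffOrd_eq hne
  obtain ⟨P', ⟨i, e, he, rfl⟩, rfl⟩ := hP
  change redPt A E i e 1 < dRes E (newtonSet A) at h1
  change sFlag E (newtonSet A) = (((dRes E (newtonSet A)).factorial / (dRes E (newtonSet A) - redPt A E i e 1) * redPt A E i e 0 : ℕ) : ℕ∞)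
    at heq
  refine ⟨i, e, he, h1, ?_⟩
  rw [hs] at heq
  have heq' := (Nat.cast_injective heq).symm
  have hdvd : (dRes E (newtonSet A) - redPt A E i e 1) ∣ (dRes E (newtonSet A)).factorial := Nat.dvd_factorial (by omega) (by omega)
  have hmul : (dRes E (newtonSet A)).factorial / (dRes E (newtonSet A) - redPt A E i e 1) * redPt A E i e 0 *
      (dRes E (newtonSet A) - redPt A E i e 1) = (dRes E (newtonSet A)).factorial * redPt A E i e 0 := by
    rw [mul_right_comm, Nat.div_mul_cancel hdvd]
  rw [← heq', ← Nat.cast_mul, hmul]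

end Slots

/-! ## Perlega Lemma 5.2.2 -/

section Shift

variable (E E' : Finset (Fin 2)) (A : Fin d → MvPowerSeries (Fin 2) k) (g : MvPowerSeries (Fin 2) k) {s : ℕ}
  (hs : (s : ℕ∞) ≤ sFlag E (newtonSet A))
  (hδ : dRes E' (newtonSet (shift d A g)) = dRes E (newtonSet A))
  (hr : excExp E' (newtonSet (shift d A g)) = excExp E (newtonSet A))

include hs hδ hr in
/-- PERLEGA LEMMA 5.2.2 (1), scaled: if all reduced points of `A` lie on or above the `s`-line and `g` lies on or above it in the sense
`s·δ + w_s(r) ≤ d!·ord_{w_s}(g)`, then — the re-centring preserving `(δ, r)` — all reduced points of `shift d A g` lie on or above it. -/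
theorem natCast_le_sFlag_shift
    (hg : ((s * dRes E (newtonSet A) + Finsupp.weight ![(dRes E (newtonSet A)).factorial, s] (excExp E (newtonSet A)) : ℕ) : ℕ∞) ≤
      (d.factorial : ℕ∞) * g.weightedOrder ![(dRes E (newtonSet A)).factorial, s]) :
    (s : ℕ∞) ≤ sFlag E' (newtonSet (shift d A g)) := by
  rw [natCast_le_sFlag_iff_le_wMin, hδ, hr]
  rw [natCast_le_sFlag_iff_le_wMin] at hs
  exact le_iInf fun i => le_trans (le_min hs hg) (min_le_slotWOrd_shift _ A g i)

include hs hδ hr in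
/-- PERLEGA LEMMA 5.2.2 (3), scaled: if all reduced points of `A` lie on or above the `s`-line but `d!·ord_{w_s}(g) < s·δ + w_s(r)`
(`g` has a monomial strictly below the line), then the re-centred tuple has a reduced point strictly below it: `sFlag(shift d A g) < s`. -/
theorem sFlag_shift_lt (hd : 0 < d)
    (hg : (d.factorial : ℕ∞) * g.weightedOrder ![(dRes E (newtonSet A)).factorial, s] <
      ((s * dRes E (newtonSet A) + Finsupp.weight ![(dRes E (newtonSet A)).factorial, s] (excExp E (newtonSet A)) : ℕ) : ℕ∞)) :
    sFlag E' (newtonSet (shift d A g)) < s := by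
  rw [natCast_le_sFlag_iff_le_wMin] at hs
  by_contra h
  rw [not_lt, natCast_le_sFlag_iff_le_wMin, hδ, hr, wMin_shift_eq_of_gt _ A g hd (lt_of_lt_of_le hg hs)] at h
  exact absurd (lt_of_lt_of_le hg h) (lt_irrefl _)

end Shift

end WildMonic

end Summit.ResolutionOfSingularities.ResolutionOfSingularities.Theorems

end
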